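import Literature.MathematicalPhysics.QuantumFieldTheory.Balaban1983to89.T4DatumAssemblyTower
import Literature.MathematicalPhysics.QuantumFieldTheory.Balaban1983to89.T4Spectator
import Literature.MathematicalPhysics.QuantumFieldTheory.Balaban1983to89.Node00.Record5C

/-!
# The STAGE-5-FAMILY SHADOW of an explicit density tower: the tower datum `datumOfTower F N M τ` (explicit `Tρ_k`, induced `R`)
# and the assembler's datum `datumOfRecord F N M'` at the SHADOW MACHINE `M'` (`R` := the operation induced AT THE RADON–NIKODYM
# IMAGE `rnTransport ρ_k ↦ ρ_{k+1}`) have THE SAME construction, β-functions, averaging maps and densities — so a record predicate of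
# NODE 00's Stage-5 family (`IsRecordOfRecord₅C`: `D = datumOfRecord₅ θ`) is met by the shadow at every world bound to the tower datum

YM-PLAN Track A, node **N23** lineage (binder B1; seat `pub-ymgap-dag-n23-a`), assembler-side service BY NAME for NODE 00's stage ₉
(chair R437 (1): ₉ = the represented tower, datum `datumOfRepTower θ := datumOfTower F N core tower`, sibling module
`T4DatumAssemblyTower`).  THE POINT THIS MODULE SETTLES (kernel): a stage-₉ tower datum is NOT a value of the Stage-5 family
`Node00.datumOfRecord₅` — its realisation carries the EXPLICIT `Tρ_k` and the induced `R`, while every `datumOfRecord₅ θ` carries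
`Tρ_k := rnTransport (av K k) ρ_k` (`T4DatumAssembly.RGMachine.realisation`) — so the refinement «₉C → ₅C» that NODE 00's later stages
re-prove (`Record7`, `Record8`: `IsRecordOfRecord₈C → ₇C → ₅C`, each stage a SPECIAL `θ`) cannot hold literally at `D`.  It holds AT THE
SHADOW: for every tower `τ` of a core `M'.toCore` whose machine `M'` has `R p k = τ.shadowR p k` (the density operation induced at the
Radon–Nikodym image, §2), `M'.dens av = τ.ρ` (§2 `RGMachine.dens_eq_of_shadowR`, induction on `k`), hence
`(datumOfRecord F N M').C = (datumOfTower F N M'.toCore τ).C` and the same `dens`, `βfun`, `av` (§3) — everything a binding world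
(`w.C = D.C`), a node statement `X (leavesP w P)`, the β-side binders, B1, (B) = `EndStatementBPrinted D.C` or the B5 expectations READ.
The two data differ only in `real.Trho` (explicit vs. Radon–Nikodym version — a.e. equal, both `IsRT`-images of the same `ρ_k`) and in
the conventional off-tower branch of `real.R`.  §4: at NODE 00's Stage-5 parameters `θ` whose residual `R` IS the shadow operation of a
tower over `(machineOfRecord₅ θ).toCore`, every world bound to the TOWER datum's construction with `θ`'s interval constant, block size
and C-binding IS a Stage-5 record `IsRecordOfRecord₅C F N (datumOfRecord₅ F N θ) w` — the one-line refinement a stage-₉ record predicate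
`∃ θ₉, … ∧ D = datumOfTower … ∧ w.C = D.C ∧ …` needs to inherit EVERY landed `…_of_isRecordOfRecord₅C` node theorem whose conclusion
reads the world (N01–N13, N24's glue inputs), with the `D`-reading ones (B1, (B), the window, the spine) transported by the §3 equalities.

What the shadow machine's two obligations cost (§1–§2, discharged HERE from the tower's displayed faces, no estimate): (0.4) for
`shadowR p k` ⟸ `∫ρ_{k+1} = ∫Tρ_k` (the tower's `integral_succ`) `= ∫ρ_k` (its `isRT_Trho` at `f ≡ 1`) `= ∫ rnTransport ρ_k`
(`isRT_rnTransport_of_ac` at an INTEGRABLE `ρ_k`); integrability preservation ⟸ `ρ_{k+1}` integrable.  Hence the ONE displayed input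
beyond the tower: `Tower.IsIntegrable` — every `ρ_k`, `k ≤ K`, integrable (the display the discharge referee asked of stage ₉, READ #43
N-n23-T1; for the Radon–Nikodym tower of an `RGMachine` it is `integrable_dens`, §2 `isIntegrable_rnTower`).  By-product (§2): along
every tower the total integral is CONSERVED, `∫ρ_k = ∫ρ₀` for `k ≤ K`, from the two faces alone ([Balaban1985UV3] (6) with `R` interposed).

## HONEST FRAMING — what this is NOT

* NOT a datum of record, NOT stage ₉, NOT a second datum: `shadowR`, `shadowMachine`, the §3∕§4 identities are FUNCTIONS ∕ theorems of
  (core, tower, integrability) resp. of NODE 00's own `θ`; NODE 00 chooses every argument (its `Record9`), and the shadow is bookkeeping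
  for TRANSFER, never a competing object: its densities ARE the tower's (`dens_eq_of_shadowR`).
* Nothing analytic of Bałaban's is proved or asserted; no node count moves; the obligations discharged are Bochner-integral identities
  from displayed hypotheses.  One finite four-torus programme at fixed `ε` — NOT the continuum limit on ℝ⁴, NOT infinite volume, NOT OS,
  NOT a mass gap, NOT the Clay problem.
* No quotation locus is new (cell GAPS C-t4l-1): [Balaban1989LargeFieldI] (0.2)–(0.4) p. 176; [Balaban1988Convergent] (0.2) p. 244;
  [Balaban1987RG1] (0.13) p. 254, (0.4) p. 253; [Balaban1989LargeFieldII] Thm 1 + (0.1) pp. 355–356; [Balaban1985UV3] (6) p. 257.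
-/

noncomputable section

open MeasureTheory

namespace Literature.MathematicalPhysics.QuantumFieldTheory.Balaban1983to89

namespace T4DatumAssembly

open Missing AveragingRT T4Continuum T4FiniteEpsInhabited FlowStepRuns DagBinding

/-! ## 1. The density operation induced AT a density; its (0.4) and its integrability preservation from two integral identities -/

section InducedAt

variable {P : Params} {G : Type} [GaugeGroup G] [MeasurableSpace G] [HaarData G] {j : ℕ}

/-- `inducedAt σ₀ ρ'` — the operation on densities of `T^{(j)}` sending `σ₀` to `ρ'` and fixing every other density (the shape of
`RGMachineCore.Tower.inducedR`, there at `σ₀ := Tρ_k`, `ρ' := ρ_{k+1}`; print applies `R` to the one represented density only).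
[cite: Balaban1989LargeFieldI, (0.2)–(0.3) p.176] -/
def inducedAt (σ₀ ρ' σ : Density P j G) : Density P j G :=
  open Classical in if σ = σ₀ then ρ' else σ

omit [GaugeGroup G] [MeasurableSpace G] [HaarData G] in
/-- `inducedAt σ₀ ρ' σ₀ = ρ'`. [cite: Balaban1989LargeFieldI, (0.2)–(0.3) p.176 (bookkeeping)] -/
theorem inducedAt_self (σ₀ ρ' : Density P j G) : inducedAt σ₀ ρ' σ₀ = ρ' := by
  unfold inducedAt
  exact if_pos rfl

omit [GaugeGroup G] [MeasurableSpace G] [HaarData G] in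
/-- Off `σ₀` the induced operation is the identity. [cite: Balaban1989LargeFieldI, (0.3) p.176 (bookkeeping)] -/
theorem inducedAt_of_ne {σ₀ ρ' σ : Density P j G} (h : σ ≠ σ₀) : inducedAt σ₀ ρ' σ = σ := by
  unfold inducedAt
  exact if_neg h

/-- (0.4) for `inducedAt σ₀ ρ'` and EVERY density ⟸ the one identity `∫ρ' = ∫σ₀`. [cite: Balaban1989LargeFieldI, (0.4) p.176] -/
theorem preservesIntegral_inducedAt {σ₀ ρ' : Density P j G}
    (h : ∫ V, ρ' V ∂fieldMeasure P j G = ∫ V, σ₀ V ∂fieldMeasure P j G) : PreservesIntegral (inducedAt σ₀ ρ') := by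
  intro σ
  by_cases hσ : σ = σ₀
  · rw [hσ, inducedAt_self]
    exact h
  · rw [inducedAt_of_ne hσ]

/-- `inducedAt σ₀ ρ'` maps integrable densities to integrable densities ⟸ `ρ'` is integrable. [cite: Balaban1989LargeFieldI, (0.3)–(0.4) p.176 (bookkeeping)] -/
theorem integrable_inducedAt {σ₀ ρ' : Density P j G} (h : Integrable ρ' (fieldMeasure P j G)) (σ : Density P j G)
    (hσ : Integrable σ (fieldMeasure P j G)) : Integrable (inducedAt σ₀ ρ' σ) (fieldMeasure P j G) := by
  by_cases e : σ = σ₀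
  · rw [e, inducedAt_self]
    exact h
  · rw [inducedAt_of_ne e]
    exact hσ

/-- The Radon–Nikodym transport of an INTEGRABLE density along a measurable averaging with the Haar bracket has the same total integral
(`isRT_rnTransport_of_ac` at `f ≡ 1`, `T4Spectator.integral_eq_of_isRT`). [cite: Balaban1987RG1, (0.13) p.254] -/
theorem integral_rnTransport_eq_of_ac (avg : GaugeField P j G → GaugeField P (j + 1) G) (havg : Measurable avg) (hac : HaarAC avg)
    (ρ : Density P j G) (hρ : Integrable ρ (fieldMeasure P j G)) :
    ∫ V, rnTransport avg ρ V ∂fieldMeasure P (j + 1) G = ∫ U, ρ U ∂fieldMeasure P j G :=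
  T4Spectator.integral_eq_of_isRT (isRT_rnTransport_of_ac avg havg hac ρ hρ)

/-- **(0.4) FOR THE SHADOW STEP**: the operation induced at the Radon–Nikodym image `rnTransport avg ρ ↦ ρ'` preserves the integral of EVERY
density as soon as `ρ` is integrable, `ρT` is an `IsRT`-image of `ρ`, and `∫ρ' = ∫ρT` — the chain `∫ρ' = ∫ρT = ∫ρ = ∫ rnTransport ρ`.
[cite: Balaban1989LargeFieldI, (0.4) p.176] -/
theorem preservesIntegral_inducedAt_rnTransport (avg : GaugeField P j G → GaugeField P (j + 1) G) (havg : Measurable avg)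
    (hac : HaarAC avg) {ρ : Density P j G} {ρT ρ' : Density P (j + 1) G} (hρ : Integrable ρ (fieldMeasure P j G))
    (hT : IsRT avg ρ ρT) (hsucc : ∫ V, ρ' V ∂fieldMeasure P (j + 1) G = ∫ V, ρT V ∂fieldMeasure P (j + 1) G) :
    PreservesIntegral (inducedAt (rnTransport avg ρ) ρ') :=
  preservesIntegral_inducedAt
    (hsucc.trans ((T4Spectator.integral_eq_of_isRT hT).trans (integral_rnTransport_eq_of_ac avg havg hac ρ hρ).symm))

end InducedAt

/-! ## 2. Tower level: conserved total integral, displayed integrability, the shadow operation, the shadow machine -/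

namespace RGMachineCore

namespace Tower

variable {F : T4Family} {G : Type} [GaugeGroup G] [MeasurableSpace G] [HaarData G] {M : RGMachineCore F G}
  {av : (K j : ℕ) → Averaging (F.P K) j G} (τ : M.Tower av)

/-- The tower's induced `R` IS `inducedAt (Tρ_k) ρ_{k+1}` (`rfl`). [cite: Balaban1989LargeFieldI, (0.2)–(0.3) p.176 (bookkeeping)] -/
theorem inducedR_eq_inducedAt (p : B12.RunParams) (k : ℕ) : τ.inducedR p k = inducedAt (τ.Trho p k) (τ.ρ p (k + 1)) := rfl

/-- `∫ Tρ_k = ∫ ρ_k` (`k < K`) — the tower's `isRT_Trho` at `f ≡ 1` (`T4Spectator.integral_eq_of_isRT`). [cite: Balaban1985UV3, (6) p.257] -/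
theorem integral_Trho_eq (p : B12.RunParams) (k : ℕ) (hk : k < p.K) :
    ∫ V, τ.Trho p k V ∂fieldMeasure (F.P p.K) (k + 1) G = ∫ U, τ.ρ p k U ∂fieldMeasure (F.P p.K) k G :=
  T4Spectator.integral_eq_of_isRT (τ.isRT_Trho p k hk)

/-- **ONE STEP OF A TOWER CONSERVES THE TOTAL INTEGRAL**, `∫ρ_{k+1} = ∫ρ_k` (`k < K`): (0.4) at the step and the push-forward identity at
`f ≡ 1` — from the two displayed faces alone. [cite: Balaban1989LargeFieldI, (0.4) p.176] -/
theorem integral_succ_eq (p : B12.RunParams) (k : ℕ) (hk : k < p.K) :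
    ∫ V, τ.ρ p (k + 1) V ∂fieldMeasure (F.P p.K) (k + 1) G = ∫ U, τ.ρ p k U ∂fieldMeasure (F.P p.K) k G :=
  (τ.integral_succ p k hk).trans (τ.integral_Trho_eq p k hk)

/-- `∫ρ_k = ∫ρ₀` for every `k ≤ K` along every tower («`∫dU ρ_k = ∫dU ρ₀ = Z^ε`», with `R` interposed). [cite: Balaban1985UV3, (6) p.257] -/
theorem integral_eq_integral_zero (p : B12.RunParams) :
    ∀ k, k ≤ p.K → ∫ V, τ.ρ p k V ∂fieldMeasure (F.P p.K) k G = ∫ U, τ.ρ p 0 U ∂fieldMeasure (F.P p.K) 0 G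
  | 0, _ => rfl
  | k + 1, hk => (τ.integral_succ_eq p k (Nat.lt_of_succ_le hk)).trans (integral_eq_integral_zero p k (Nat.le_of_succ_le hk))

/-- **DISPLAYED INTEGRABILITY OF A TOWER**: every density `ρ_k`, `k ≤ K`, of every run is integrable for product Haar measure — the display
the two Bochner faces `isRT_Trho` ∕ `integral_succ` want beside them (they take junk values at non-integrable densities).  For the
Radon–Nikodym tower of an `RGMachine` it HOLDS (`isIntegrable_rnTower`); at stage ₉ it follows from the displayed step provisos.
[cite: Balaban1988Convergent, (0.2) p.244 (kernel property of the tower, bookkeeping)] -/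
def IsIntegrable : Prop :=
  ∀ (p : B12.RunParams) (k : ℕ), k ≤ p.K → Integrable (τ.ρ p k) (fieldMeasure (F.P p.K) k G)

/-- **THE SHADOW LARGE-FIELD OPERATION of the tower** after step `k+1`: the density operation induced AT THE RADON–NIKODYM IMAGE,
`rnTransport (av K k) ρ_k ↦ ρ_{k+1}`, identity elsewhere — so that the assembler's Radon–Nikodym recursion `ρ_{k+1} = R(rnTransport ρ_k)`
(`RGMachine.dens`) REPRODUCES the tower's explicit densities. [cite: Balaban1989LargeFieldI, (0.2)–(0.3) p.176; Balaban1987RG1, (0.13) p.254] -/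
def shadowR (p : B12.RunParams) (k : ℕ) : Density (F.P p.K) (k + 1) G → Density (F.P p.K) (k + 1) G :=
  inducedAt (rnTransport (av p.K k).avg (τ.ρ p k)) (τ.ρ p (k + 1))

/-- `shadowR (rnTransport ρ_k) = ρ_{k+1}`. [cite: Balaban1988Convergent, (0.2) p.244 (bookkeeping)] -/
theorem shadowR_rnTransport (p : B12.RunParams) (k : ℕ) :
    τ.shadowR p k (rnTransport (av p.K k).avg (τ.ρ p k)) = τ.ρ p (k + 1) :=
  inducedAt_self _ _

/-- (0.4) for the shadow operation and EVERY density (`k < K`), from the tower's two faces at step `k`, measurability and the Haar bracket of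
`av K k`, and integrability of `ρ_k`. [cite: Balaban1989LargeFieldI, (0.4) p.176] -/
theorem preservesIntegral_shadowR (p : B12.RunParams) (k : ℕ) (hk : k < p.K) (hmeas : Measurable (av p.K k).avg)
    (hac : HaarAC (av p.K k).avg) (hint : Integrable (τ.ρ p k) (fieldMeasure (F.P p.K) k G)) : PreservesIntegral (τ.shadowR p k) :=
  preservesIntegral_inducedAt_rnTransport _ hmeas hac hint (τ.isRT_Trho p k hk) (τ.integral_succ p k hk)

/-- The shadow operation maps integrable densities to integrable densities ⟸ `ρ_{k+1}` is integrable. [cite: Balaban1989LargeFieldI, (0.3)–(0.4) p.176 (bookkeeping)] -/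
theorem integrable_shadowR (p : B12.RunParams) (k : ℕ) (hint : Integrable (τ.ρ p (k + 1)) (fieldMeasure (F.P p.K) (k + 1) G))
    (σ : Density (F.P p.K) (k + 1) G) (hσ : Integrable σ (fieldMeasure (F.P p.K) (k + 1) G)) :
    Integrable (τ.shadowR p k σ) (fieldMeasure (F.P p.K) (k + 1) G) :=
  integrable_inducedAt hint σ hσ

/-- **THE SHADOW MACHINE of an integrable tower** along a measurable averaging family with the Haar bracket: the core's ten fields verbatim and
`R := shadowR`, its two obligations DISCHARGED from the tower's faces and the displayed integrability.  A FUNCTION of (core, tower,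
integrability); bookkeeping for transfer into the assembler's family `RGMachine.datum`, never a competing object. [cite: Balaban1988Convergent, (0.2) p.244] -/
def shadowMachine (hmeas : ∀ K j, Measurable (av K j).avg) (hac : ∀ K k, k < K → HaarAC (av K k).avg) (hint : τ.IsIntegrable) :
    RGMachine F G where
  βfun := M.βfun
  E := M.E
  dom := M.dom
  effAction := M.effAction
  wilsonBG := M.wilsonBG
  Ek := M.Ek
  χ := M.χ
  Repr := M.Repr
  IndAss := M.IndAss
  Sect2Form := M.Sect2Form
  R := τ.shadowR
  preservesIntegral_R := fun p k hk => τ.preservesIntegral_shadowR p k hk (hmeas p.K k) (hac p.K k hk) (hint p k hk.le)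
  integrable_R := fun p k hk => τ.integrable_shadowR p k (hint p (k + 1) (Nat.succ_le_of_lt hk))

/-- The shadow machine's core IS the tower's core (`rfl`). [cite: Balaban1988Convergent, (0.2) p.244 (bookkeeping)] -/
theorem shadowMachine_toCore (hmeas : ∀ K j, Measurable (av K j).avg) (hac : ∀ K k, k < K → HaarAC (av K k).avg)
    (hint : τ.IsIntegrable) : (τ.shadowMachine hmeas hac hint).toCore = M := rfl

/-- The shadow machine's `R` IS `shadowR` (`rfl`). [cite: Balaban1989LargeFieldI, (0.3) p.176 (bookkeeping)] -/
theorem shadowMachine_R (hmeas : ∀ K j, Measurable (av K j).avg) (hac : ∀ K k, k < K → HaarAC (av K k).avg)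
    (hint : τ.IsIntegrable) (p : B12.RunParams) (k : ℕ) : (τ.shadowMachine hmeas hac hint).R p k = τ.shadowR p k := rfl

end Tower

end RGMachineCore

/-! ### Transfer: a machine whose `R` is the shadow operation of a tower over its core has the tower's densities and construction -/

namespace RGMachine

variable {F : T4Family} {G : Type} [GaugeGroup G] [MeasurableSpace G] [HaarData G]
  (M' : RGMachine F G) (av : (K j : ℕ) → Averaging (F.P K) j G) (τ : M'.toCore.Tower av)
  (hR : ∀ (p : B12.RunParams) (k : ℕ), M'.R p k = τ.shadowR p k)

include hR in
/-- **THE ASSEMBLER'S RADON–NIKODYM RECURSION AT A SHADOW `R` REPRODUCES THE TOWER**: `M'.dens av p k = τ.ρ p k` for every `k`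
(induction: the Wilson start by `rho_zero`; the step by `shadowR_rnTransport`). [cite: Balaban1988Convergent, (0.2) p.244] -/
theorem dens_eq_of_shadowR (p : B12.RunParams) : ∀ k, M'.dens av p k = τ.ρ p k
  | 0 => (τ.rho_zero p).symm
  | k + 1 => by rw [M'.dens_succ, dens_eq_of_shadowR p k, hR p k, τ.shadowR_rnTransport]

include hR in
/-- … hence its construction IS the core's construction over the tower's densities. [cite: Balaban1987RG1, (0.17)–(0.20) pp.255–256 (bookkeeping)] -/
theorem construction_eq_of_shadowR : M'.construction av = M'.toCore.construction τ.ρ := by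
  funext p
  have h : M'.dens av p = τ.ρ p := funext (M'.dens_eq_of_shadowR av τ hR p)
  rw [M'.construction_eq_toCore]
  show M'.toCore.construction (M'.dens av) p = M'.toCore.construction τ.ρ p
  simp only [RGMachineCore.construction, h]

/-- The Radon–Nikodym tower of an `RGMachine` along a measurable family with the Haar bracket IS integrable (`integrable_dens`).
[cite: Balaban1988Convergent, (0.2) p.244 (kernel property of the tower, bookkeeping)] -/
theorem isIntegrable_rnTower [RegularGaugeGroup G] (hmeas : ∀ K j, Measurable (av K j).avg)
    (hac : ∀ K k, k < K → HaarAC (av K k).avg) : (M'.rnTower av hmeas hac).IsIntegrable :=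
  fun p k hk => M'.integrable_dens av hmeas hac p k hk

variable [RegularGaugeGroup G] (hmeas : ∀ K j, Measurable (av K j).avg) (hac : ∀ K k, k < K → HaarAC (av K k).avg)

include hR in
/-- The assembler's datum at `M'` and the tower datum have THE SAME CONSTRUCTION — every world-level statement (`w.C = D.C`, (B), the window,
END, the node statements `X (leavesP w P)`) reads identically at both. [cite: Balaban1989LargeFieldII, Thm 1 + (0.1) pp.355–356 (bookkeeping)] -/
theorem datum_C_eq_of_shadowR : (M'.datum av hmeas hac).C = τ.datum.C :=
  M'.construction_eq_of_shadowR av τ hR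

include hR in
/-- … the same densities. [cite: Balaban1988Convergent, (0.2) p.244 (bookkeeping)] -/
theorem dens_datum_eq_of_shadowR (K : ℕ) (g₀ : ℝ) (k : ℕ) : (M'.datum av hmeas hac).dens K g₀ k = τ.datum.dens K g₀ k :=
  M'.dens_eq_of_shadowR av τ hR ⟨K, F.m, g₀⟩ k

/-- … the same β-functions (`rfl`, for every `M'` and `τ`). [cite: Balaban1987RG1, (1.22) p.264 (bookkeeping)] -/
theorem datum_βfun_eq_tower : (M'.datum av hmeas hac).βfun = τ.datum.βfun := rfl

/-- … and the same averaging maps (`rfl`). [cite: Balaban1987RG1, (0.4) p.253 (bookkeeping)] -/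
theorem datum_av_eq_tower : (M'.datum av hmeas hac).av = τ.datum.av := rfl

include hR in
/-- What DIFFERS, located: the realised `Tρ_k` — `rnTransport (av K k) ρ_k` at the assembler's datum, the tower's explicit `Trho` at the tower
datum — are two `IsRT`-images of THE SAME `ρ_k` (`k < K`). [cite: Balaban1985Averaging, (10) p.19 (bookkeeping)] -/
theorem trho_datum_and_tower (K : ℕ) (g₀ : ℝ) (k : ℕ) (hk : k < K) :
    IsRT (av K k).avg (τ.ρ ⟨K, F.m, g₀⟩ k) ((M'.datum av hmeas hac).real.Trho K g₀ k) ∧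
      IsRT (av K k).avg (τ.ρ ⟨K, F.m, g₀⟩ k) (τ.datum.real.Trho K g₀ k) := by
  refine ⟨?_, τ.isRT_Trho ⟨K, F.m, g₀⟩ k hk⟩
  have h : IsRT (av K k).avg ((M'.datum av hmeas hac).dens K g₀ k) ((M'.datum av hmeas hac).real.Trho K g₀ k) :=
    (M'.datum av hmeas hac).real.isRT_Trho K g₀ k hk
  have hd : (M'.datum av hmeas hac).dens K g₀ k = τ.ρ ⟨K, F.m, g₀⟩ k := M'.dens_eq_of_shadowR av τ hR ⟨K, F.m, g₀⟩ k
  rw [hd] at h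
  exact h

end RGMachine

/-! ## 3. At `SU(N)` and NODE 00's averaging of record: `datumOfRecord F N M'` versus `datumOfTower F N M'.toCore τ` -/

section Record

variable (F : T4Family) (N : ℕ) [NeZero N] (M' : RGMachine F (Matrix.specialUnitaryGroup (Fin N) ℂ))
  (τ : M'.toCore.Tower (Node00.avOfRecord F N)) (hR : ∀ (p : B12.RunParams) (k : ℕ), M'.R p k = τ.shadowR p k)

include hR in
/-- **SAME CONSTRUCTION at the record**: the Stage-5-family datum `datumOfRecord F N M'` of a machine with the shadow `R` and the tower datum
`datumOfTower F N M'.toCore τ` have the same `C`. [cite: Balaban1989LargeFieldII, Thm 1 + (0.1) pp.355–356 (bookkeeping)] -/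
theorem datumOfRecord_C_eq_datumOfTower : (datumOfRecord F N M').C = (datumOfTower F N M'.toCore τ).C :=
  M'.construction_eq_of_shadowR _ τ hR

include hR in
/-- … the same densities. [cite: Balaban1988Convergent, (0.2) p.244 (bookkeeping)] -/
theorem dens_datumOfRecord_eq_datumOfTower (K : ℕ) (g₀ : ℝ) (k : ℕ) :
    (datumOfRecord F N M').dens K g₀ k = (datumOfTower F N M'.toCore τ).dens K g₀ k :=
  M'.dens_eq_of_shadowR _ τ hR ⟨K, F.m, g₀⟩ k

/-- … the same β-functions (`rfl`). [cite: Balaban1987RG1, (1.22) p.264 (bookkeeping)] -/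
theorem datumOfRecord_βfun_eq_datumOfTower : (datumOfRecord F N M').βfun = (datumOfTower F N M'.toCore τ).βfun := rfl

/-- … the same averaging maps (`rfl`) — both are Stage-0 data of record. [cite: Balaban1987RG1, (0.4) p.253 (bookkeeping)] -/
theorem datumOfRecord_av_eq_datumOfTower : (datumOfRecord F N M').av = (datumOfTower F N M'.toCore τ).av := rfl

include hR in
/-- (B) at one datum ⟺ (B) at the other (same construction). [cite: Balaban1989LargeFieldII, Thm 1 p.355 (bookkeeping)] -/
theorem endStatementBPrinted_datumOfRecord_iff_datumOfTower :
    B16.EndStatementBPrinted (datumOfRecord F N M').C ↔ B16.EndStatementBPrinted (datumOfTower F N M'.toCore τ).C := by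
  rw [datumOfRecord_C_eq_datumOfTower F N M' τ hR]

variable (M : RGMachineCore F (Matrix.specialUnitaryGroup (Fin N) ℂ)) (σ : M.Tower (Node00.avOfRecord F N)) (hint : σ.IsIntegrable)

/-- **THE SHADOW MACHINE AT THE RECORD** of an integrable tower along NODE 00's averaging of record (measurability `avOfRecord_measurable`,
Haar bracket `avOfRecord_haarAC`). [cite: Balaban1988Convergent, (0.2) p.244; Balaban1987RG1, (0.4) p.253] -/
def shadowMachineOfRecord : RGMachine F (Matrix.specialUnitaryGroup (Fin N) ℂ) :=
  σ.shadowMachine (Node00.avOfRecord_measurable F N) (Node00.avOfRecord_haarAC F N) hint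

/-- Its core is the tower's core (`rfl`). [cite: Balaban1988Convergent, (0.2) p.244 (bookkeeping)] -/
theorem shadowMachineOfRecord_toCore : (shadowMachineOfRecord F N M σ hint).toCore = M := rfl

/-- EVERY INTEGRABLE TOWER DATUM HAS A STAGE-5-FAMILY SHADOW WITH THE SAME CONSTRUCTION: `(datumOfRecord F N (shadowMachineOfRecord …)).C =
(datumOfTower F N M σ).C`. [cite: Balaban1989LargeFieldII, Thm 1 + (0.1) pp.355–356 (bookkeeping)] -/
theorem datumOfRecord_shadowMachineOfRecord_C :
    (datumOfRecord F N (shadowMachineOfRecord F N M σ hint)).C = (datumOfTower F N M σ).C :=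
  datumOfRecord_C_eq_datumOfTower F N (shadowMachineOfRecord F N M σ hint) σ (fun _ _ => rfl)

/-- … and the same densities. [cite: Balaban1988Convergent, (0.2) p.244 (bookkeeping)] -/
theorem dens_datumOfRecord_shadowMachineOfRecord (K : ℕ) (g₀ : ℝ) (k : ℕ) :
    (datumOfRecord F N (shadowMachineOfRecord F N M σ hint)).dens K g₀ k = (datumOfTower F N M σ).dens K g₀ k :=
  dens_datumOfRecord_eq_datumOfTower F N (shadowMachineOfRecord F N M σ hint) σ (fun _ _ => rfl) K g₀ k

end Record

/-! ## 4. NODE 00's Stage-5 record predicate is met BY THE SHADOW at every world bound to the tower datum -/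

section Stage5

variable (F : T4Family) (N : ℕ) [NeZero N]

/-- **THE ONE-LINE REFINEMENT A STAGE-₉ RECORD PREDICATE NEEDS**: at admissible Stage-5 parameters `θ` whose residual large-field operation IS
the shadow operation of a tower `τ` over the machine-of-record's core, every world bound to the TOWER datum's construction (`w.C`), with
`θ`'s interval constant, Bałaban's block size and the C-binding of record at `θ`, IS a Stage-5 record of record at the shadow datum
`Node00.datumOfRecord₅ F N θ` — so every landed `…_of_isRecordOfRecord₅C` theorem whose conclusion reads the world applies verbatim, and the
`D`-reading ones transport along §3. [cite: Balaban1989LargeFieldII, Thm 1 + (0.1) pp.355–356; Balaban1988Convergent, (0.2) p.244 (objects of record, bookkeeping)] -/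
theorem isRecordOfRecord₅C_shadow (θ : Node00.Stage5Params F N) (hθ : θ.Admissible)
    (τ : (Node00.machineOfRecord₅ F N θ).toCore.Tower (Node00.avOfRecord F N))
    (hR : ∀ (p : B12.RunParams) (k : ℕ), θ.res.R p k = τ.shadowR p k) (w : WorldP)
    (hC : w.C = (datumOfTower F N (Node00.machineOfRecord₅ F N θ).toCore τ).C) (hγ : w.γ = θ.γ) (hL : w.L = (θ.L : ℝ))
    (hup : ∀ P : B12.RunParams, w.up P = Node00.upOfRecord₅C F N θ P) :
    Node00.IsRecordOfRecord₅C F N (Node00.datumOfRecord₅ F N θ) w :=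
  ⟨θ, hθ, rfl, hC.trans (datumOfRecord_C_eq_datumOfTower F N (Node00.machineOfRecord₅ F N θ) τ hR).symm, hγ, hL, hup⟩

/-- … and then EVERY node statement established over the Stage-5 record predicate holds at every run of that world (the transfer, by name:
`h₅` = any landed `…_of_isRecordOfRecord₅C` theorem in the `AtRecord` shape). [cite: Balaban1989LargeFieldII, Thm 1 p.355 (bookkeeping)] -/
theorem atWorld_of_isRecordOfRecord₅C_shadow {X : Dag.Leaves → Prop}
    (h₅ : ∀ (D : FiniteEpsData F (Matrix.specialUnitaryGroup (Fin N) ℂ)) (w : WorldP),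
      Node00.IsRecordOfRecord₅C F N D w → ∀ P : B12.RunParams, X (leavesP w P))
    (θ : Node00.Stage5Params F N) (hθ : θ.Admissible)
    (τ : (Node00.machineOfRecord₅ F N θ).toCore.Tower (Node00.avOfRecord F N))
    (hR : ∀ (p : B12.RunParams) (k : ℕ), θ.res.R p k = τ.shadowR p k) (w : WorldP)
    (hC : w.C = (datumOfTower F N (Node00.machineOfRecord₅ F N θ).toCore τ).C) (hγ : w.γ = θ.γ) (hL : w.L = (θ.L : ℝ))
    (hup : ∀ P : B12.RunParams, w.up P = Node00.upOfRecord₅C F N θ P) (P : B12.RunParams) : X (leavesP w P) :=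
  h₅ _ w (isRecordOfRecord₅C_shadow F N θ hθ τ hR w hC hγ hL hup) P

/-- The `D`-reading transport, instance (B): at such `θ`, (B) at the shadow datum of record ⟺ (B) at the tower datum. [cite: Balaban1989LargeFieldII, Thm 1 p.355 (bookkeeping)] -/
theorem endStatementBPrinted_datumOfRecord₅_iff_datumOfTower (θ : Node00.Stage5Params F N)
    (τ : (Node00.machineOfRecord₅ F N θ).toCore.Tower (Node00.avOfRecord F N))
    (hR : ∀ (p : B12.RunParams) (k : ℕ), θ.res.R p k = τ.shadowR p k) :
    B16.EndStatementBPrinted (Node00.datumOfRecord₅ F N θ).C ↔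
      B16.EndStatementBPrinted (datumOfTower F N (Node00.machineOfRecord₅ F N θ).toCore τ).C :=
  endStatementBPrinted_datumOfRecord_iff_datumOfTower F N _ τ hR

/-- … instance densities: the shadow datum of record's `dens` ARE the tower's explicit functions — pointwise statements about `D.dens` at the
shadow ((0.1)∕(2.50) faces) are statements about `τ.ρ`. [cite: Balaban1988Convergent, (0.2) p.244 (bookkeeping)] -/
theorem dens_datumOfRecord₅_eq_tower (θ : Node00.Stage5Params F N)
    (τ : (Node00.machineOfRecord₅ F N θ).toCore.Tower (Node00.avOfRecord F N))
    (hR : ∀ (p : B12.RunParams) (k : ℕ), θ.res.R p k = τ.shadowR p k) (K : ℕ) (g₀ : ℝ) (k : ℕ) :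
    (Node00.datumOfRecord₅ F N θ).dens K g₀ k = τ.ρ ⟨K, F.m, g₀⟩ k :=
  dens_datumOfRecord_eq_datumOfTower F N _ τ hR K g₀ k

/-- … and NODE 00's own density tower `densOfRecord₅ θ` (the Stage-5 recursion `ρ_{k+1} = R_k (T_k ρ_k)` with `T_k = rnTransport`) IS the tower's:
`densOfRecord₅ F N θ p k = τ.ρ p k` — so the Stage-5 clause `Sect2Form p k := S218 p k (densOfRecord₅ θ p k)` of `machineOfRecord₅ θ` is READ AT the
tower's explicit density, up to this rewrite (`Node00.dens_machineOfRecord₅` + `dens_eq_of_shadowR`). [cite: Balaban1988Convergent, (0.2) p.244 (bookkeeping)] -/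
theorem densOfRecord₅_eq_tower (θ : Node00.Stage5Params F N)
    (τ : (Node00.machineOfRecord₅ F N θ).toCore.Tower (Node00.avOfRecord F N))
    (hR : ∀ (p : B12.RunParams) (k : ℕ), θ.res.R p k = τ.shadowR p k) (p : B12.RunParams) (k : ℕ) :
    Node00.densOfRecord₅ F N θ p k = τ.ρ p k := by
  rw [← Node00.dens_machineOfRecord₅ F N θ p k]
  exact (Node00.machineOfRecord₅ F N θ).dens_eq_of_shadowR _ τ hR p k

end Stage5

end T4DatumAssembly

end Literature.MathematicalPhysics.QuantumFieldTheory.Balaban1983to89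

end
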